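import Mathlib
import Summits.ValiantsHypothesis.ValiantsHypothesis.Theorems.LiouvilleSarnakAlignedTypeICharactersMod2nBilinearSieveKorobovMain
import Summits.ValiantsHypothesis.ValiantsHypothesis.Theorems.LiouvilleSarnakAlignedTypeICharactersMod2nBilinearSieveGrowthFromCharSums
import Summits.ValiantsHypothesis.ValiantsHypothesis.Theorems.LiouvilleSarnakAlignedTypeICharactersMod2nStubIsCrux
import HarnessLib

/-!
# Route LiouvilleSarnak — `AlignedTypeI` (stmt-ValiantsHypothesis-21040), line `characters_mod_2n`:
# the short character sum bound `HS` for `2`-power moduli, and the leaf UNCONDITIONALLY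

This file closes the chain built by the leafhand seats on the line `characters_mod_2n`:

* `norm_charSum_le_main` — the Postnikov–Gallagher–Korobov block bound `…KorobovMain.norm_charSum_Ioc_le_main`
  for a primitive `χ` mod `2^j` in the split-free form (the modulus `2^j` is rewritten as `2^{n+τ}`,
  `τ = ⌊j/(r+1)⌋ + 2`, `r = ⌊5.01Y⌋`);
* `shortCharSums_bound` — ★★ `HS(e^{10} + 8, 2·10⁻⁹)`: for `j ≥ 1`, `χ` primitive mod `2^j`, `1 ≤ N ≤ 2^j`,
  `‖Σ_{n ≤ N} χ(n)‖ ≤ (e^{10} + 8) N exp(−2·10⁻⁹ log³N / log²(2^j))` (Postnikov 1955 / Gallagher 1972 / Iwaniec 1974 —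
  the depth-aspect analogue of Vinogradov's zeta-sum estimate, Ivić Thm 6.2): in the range `log³N > 10⁹ log²q`
  either `N ≤ q^{1/10}` (parameters `L = log N`, `Y = log q/log N`) or `N > q^{1/10}` (parameters `L = log q/10`,
  `Y = 10`, saving `exp(−2·10⁻⁹ log q)`); the complementary range is trivial;
* `alignedTypeI_proof` — ★★★ `Summit.ValiantsHypothesis.ValiantsHypothesis.Theses.LiouvilleSarnak.AlignedTypeI`,
  UNCONDITIONALLY, by `alignedTypeI_of_shortCharSums` (`…GrowthFromCharSums.lean`: `HS ⟹ HG ⟹ HZ ⟹` the leaf);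
* `stub_kmtVariance`, `stub_twistedLiouvilleSmall` — the two registered stubs of the line BY NAME
  (`kmtVariance_iff_alignedTypeI`, `twistedLiouvilleSmall_of_alignedTypeI` of `…StubIsCrux.lean`).

HONEST FRAMING. `AlignedTypeI` (the aligned Type-I `ℓ¹` bound for `λ` on the digital rectangles `a + 2^n b`) is a
LEAF of the route `LiouvilleSarnak`: a known-type analytic statement, here PROVED from the tree's Vinogradov–Korobov
machinery.  It is the first instance of the crux `DigitalBilinearLiouville`; it does NOT prove that crux, nor
`LiouvilleCutRank`, and nothing here bears on `VP ≠ VNP` (NOT proved).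
-/

set_option linter.dupNamespace false

noncomputable section

namespace Summit.ValiantsHypothesis.ValiantsHypothesis.Theorems.LiouvilleSarnak.AlignedTypeI.CharactersModTwoN

open Finset Real
open Literature.NumberTheory.LFunctions

/-! ### The block bound for a primitive character mod `2^j` -/

/-- **The main-range bound for `χ` mod `2^j`**: for a primitive `χ` mod `2^j`, `Y ≥ 10`, `L ≥ 10⁶Y²`, `j log 2 = Y L`:
`‖Σ_{0<m≤N} χ(m)‖ ≤ N e^{10} exp(−2·10⁻⁶ L/Y²) + 8 e^{0.98 L}` (`…KorobovMain.norm_charSum_Ioc_le_main` after the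
split `j = n + τ`). [cite: Ivic1985, Theorem 6.2] [cite: IwaniecKowalski2004, §12.3] -/
theorem norm_charSum_le_main (j : ℕ) (χ : DirichletCharacter ℂ (2 ^ j)) (hχ : χ.IsPrimitive)
    {L Y : ℝ} (hY : 10 ≤ Y) (hL : (10 : ℝ) ^ 6 * Y ^ 2 ≤ L) (hjYL : (j : ℝ) * Real.log 2 = Y * L) (N : ℕ) :
    ‖∑ m ∈ Ioc 0 (0 + N), χ (m : ZMod (2 ^ j))‖ ≤
      (N : ℝ) * Real.exp 10 * Real.exp (-(2e-6 * L / Y ^ 2)) + 8 * Real.exp (0.98 * L) := by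
  set r : ℕ := ⌊5.01 * Y⌋₊ with hr
  set τ : ℕ := j / (r + 1) + 2 with hτ
  have hb := params_basic (a := ⌊Real.exp (0.39 * L)⌋₊) (M₂ := ⌊2 * Y⌋₊) (M₃ := ⌊3.5 * Y⌋₊)
    hY hL hjYL hr hτ rfl rfl rfl
  have hτj : τ + 1 ≤ j := hb.2.2.2.2.1
  clear hb
  clear_value r τ
  obtain ⟨n, rfl⟩ : ∃ n, j = n + τ := ⟨j - τ, by omega⟩
  exact norm_charSum_Ioc_le_main χ hχ hY hL hjYL hr hτ 0 N

/-! ### `HS` -/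

/-- ★★ **Short character sums to `2`-power moduli** (`HS(e^{10} + 8, 2·10⁻⁹)`; Postnikov–Gallagher–Iwaniec, the
`q`-analogue of Ivić's Theorem 6.2): for `j ≥ 1`, `χ` primitive mod `2^j` and `1 ≤ N ≤ 2^j`,
`‖Σ_{n<N} χ(n+1)‖ ≤ (e^{10} + 8) N exp(−2·10⁻⁹ log³N/log²(2^j))`.
[cite: Ivic1985, Theorem 6.2] [cite: IwaniecKowalski2004, Theorem 12.16 (Postnikov–Gallagher)] -/
theorem shortCharSums_bound :
    ∀ j : ℕ, 1 ≤ j → ∀ χ : DirichletCharacter ℂ (2 ^ j), χ.IsPrimitive → ∀ N : ℕ, 1 ≤ N → N ≤ 2 ^ j →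
      ‖∑ n ∈ Finset.range N, χ ((n + 1 : ℕ) : ZMod (2 ^ j))‖ ≤
        (Real.exp 10 + 8) * N * Real.exp (-(2e-9 : ℝ) * Real.log N ^ 3 / Real.log ((2 : ℝ) ^ j) ^ 2) := by
  intro j hj χ hχ N hN1 hNq
  -- reindex the sum over `(0, N]`
  have hre : ∀ K : ℕ, ∑ n ∈ Finset.range K, χ ((n + 1 : ℕ) : ZMod (2 ^ j)) =
      ∑ m ∈ Ioc 0 (0 + K), χ (m : ZMod (2 ^ j)) := by
    intro K
    induction K with
    | zero => simp
    | succ K ih =>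
      rw [sum_range_succ, ih, show 0 + (K + 1) = 0 + K + 1 by ring, Finset.sum_Ioc_succ_top (by omega)]
      push_cast
      ring_nf
  rw [hre N]
  set S := ∑ m ∈ Ioc 0 (0 + N), χ (m : ZMod (2 ^ j)) with hS
  -- the quantities `Q = log q`, `L = log N`
  set Q : ℝ := Real.log ((2 : ℝ) ^ j) with hQ
  set L : ℝ := Real.log N with hLdef
  have hQj : Q = (j : ℝ) * Real.log 2 := by rw [hQ, Real.log_pow]
  have hl0 : 0 < Real.log 2 := Real.log_pos (by norm_num)
  have hQ0 : 0 < Q := by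
    rw [hQj]; have : (1 : ℝ) ≤ j := by exact_mod_cast hj
    positivity
  have hN0 : (0 : ℝ) < N := by exact_mod_cast hN1
  have hL0 : 0 ≤ L := Real.log_nonneg (by exact_mod_cast hN1)
  have hLQ : L ≤ Q := by
    rw [hLdef, hQ]
    exact Real.log_le_log hN0 (by exact_mod_cast hNq)
  have hNexp : Real.exp L = N := by rw [hLdef, Real.exp_log hN0]
  -- the trivial bound
  have htriv : ‖S‖ ≤ N := by
    rw [hS]
    refine (norm_sum_le _ _).trans ?_
    have : ∀ m ∈ Ioc 0 (0 + N), ‖χ (m : ZMod (2 ^ j))‖ ≤ 1 := fun m _ => χ.norm_le_one _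
    refine (sum_le_sum this).trans ?_
    simp
  set E' : ℝ := Real.exp (-(2e-9 : ℝ) * L ^ 3 / Q ^ 2) with hE'
  have hE'0 : 0 < E' := Real.exp_pos _
  have hC : (0 : ℝ) ≤ Real.exp 10 + 8 := by positivity
  by_cases hmain : (10 : ℝ) ^ 9 * Q ^ 2 < L ^ 3
  · -- the main range: `L > 0`
    have hLpos : 0 < L := by
      rcases hL0.eq_or_lt with h | h
      · rw [← h] at hmain; nlinarith [sq_nonneg Q]
      · exact h
    have hL3Q3 : L ^ 3 ≤ Q ^ 3 := pow_le_pow_left₀ hL0 hLQ 3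
    by_cases hY10 : 10 * L ≤ Q
    · -- `N ≤ q^{1/10}`: parameters `L`, `Y = Q/L`
      set Y : ℝ := Q / L with hYdef
      have hYL : Y * L = Q := by rw [hYdef]; field_simp
      have hY : 10 ≤ Y := by rw [hYdef, le_div_iff₀ hLpos]; linarith
      have hY0 : 0 < Y := by linarith
      have hLY : (10 : ℝ) ^ 6 * Y ^ 2 ≤ L := by
        -- `10⁶ Q²/L² ≤ L ⟺ 10⁶ Q² ≤ L³`
        have h1 : (10 : ℝ) ^ 6 * Q ^ 2 ≤ L ^ 3 := by nlinarith [sq_nonneg Q]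
        have h2 : Y ^ 2 * L ^ 2 = Q ^ 2 := by rw [← hYL]; ring
        nlinarith [sq_nonneg Y, sq_nonneg L, mul_pos hLpos hLpos]
      have hjYL : (j : ℝ) * Real.log 2 = Y * L := by rw [← hQj, hYL]
      have hB := norm_charSum_le_main j χ hχ hY hLY hjYL N
      -- `L/Y² = L³/Q²`
      have hLY2 : L / Y ^ 2 = L ^ 3 / Q ^ 2 := by
        rw [hYdef]; field_simp
      have hexp : -(2e-6 * L / Y ^ 2) = -(2e-6 * (L ^ 3 / Q ^ 2)) := by rw [mul_div_assoc, hLY2]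
      rw [hexp] at hB
      have hQ2 : (0 : ℝ) < Q ^ 2 := by positivity
      -- `exp(−2·10⁻⁶ L³/Q²) ≤ E'`
      have hE1 : Real.exp (-(2e-6 * (L ^ 3 / Q ^ 2))) ≤ E' := by
        rw [hE']; apply Real.exp_le_exp.2
        have : 0 ≤ L ^ 3 / Q ^ 2 := by positivity
        have e1 : -(2e-9 : ℝ) * L ^ 3 / Q ^ 2 = -(2e-9 * (L ^ 3 / Q ^ 2)) := by ring
        rw [e1]
        linarith
      -- `8 e^{0.98L} ≤ 8 N exp(−2·10⁻⁶ L³/Q²)`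
      have hE2 : Real.exp (0.98 * L) ≤ (N : ℝ) * Real.exp (-(2e-6 * (L ^ 3 / Q ^ 2))) := by
        rw [← hNexp, ← Real.exp_add]
        apply Real.exp_le_exp.2
        have h1 : 2e-6 * (L ^ 3 / Q ^ 2) ≤ 0.02 * L := by
          rw [mul_div_assoc', div_le_iff₀ hQ2]
          have hQL : 100 * L ^ 2 ≤ Q ^ 2 := by
            nlinarith [mul_nonneg (sub_nonneg.2 hY10) (by positivity : (0 : ℝ) ≤ Q + 10 * L)]
          have h2 : 0.02 * L * (100 * L ^ 2) ≤ 0.02 * L * Q ^ 2 :=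
            mul_le_mul_of_nonneg_left hQL (by positivity)
          have h3 : 0.02 * L * (100 * L ^ 2) = 2 * L ^ 3 := by ring
          have h4 : 0 < L ^ 3 := pow_pos hLpos 3
          linarith
        linarith
      have hN0' : (0 : ℝ) ≤ N := hN0.le
      calc ‖S‖ ≤ (N : ℝ) * Real.exp 10 * Real.exp (-(2e-6 * (L ^ 3 / Q ^ 2))) + 8 * Real.exp (0.98 * L) := hB
        _ ≤ (N : ℝ) * Real.exp 10 * E' + 8 * ((N : ℝ) * E') := by
            have h3 : (N : ℝ) * Real.exp (-(2e-6 * (L ^ 3 / Q ^ 2))) ≤ (N : ℝ) * E' :=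
              mul_le_mul_of_nonneg_left hE1 hN0'
            have h4 : (N : ℝ) * Real.exp 10 * Real.exp (-(2e-6 * (L ^ 3 / Q ^ 2))) ≤ (N : ℝ) * Real.exp 10 * E' :=
              mul_le_mul_of_nonneg_left hE1 (by positivity)
            linarith
        _ = (Real.exp 10 + 8) * N * E' := by ring
    · -- `N > q^{1/10}`: parameters `L' = Q/10`, `Y = 10`
      push Not at hY10
      have hQ9 : (10 : ℝ) ^ 9 < Q := by
        by_contra h
        push Not at h
        have : L ^ 3 ≤ (10 : ℝ) ^ 9 * Q ^ 2 := by nlinarith [sq_nonneg Q]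
        linarith
      have hL' : (10 : ℝ) ^ 6 * (10 : ℝ) ^ 2 ≤ Q / 10 := by
        rw [le_div_iff₀ (by norm_num : (0 : ℝ) < 10)]; nlinarith
      have hjYL : (j : ℝ) * Real.log 2 = 10 * (Q / 10) := by rw [← hQj]; ring
      have hB := norm_charSum_le_main j χ hχ (le_refl (10 : ℝ)) hL' hjYL N
      have hsimp : -(2e-6 * (Q / 10) / (10 : ℝ) ^ 2) = -(2e-9 * Q) := by ring
      rw [hsimp] at hB
      -- `exp(−2·10⁻⁹ Q) ≤ E'`
      have hE1 : Real.exp (-(2e-9 * Q)) ≤ E' := by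
        rw [hE']; apply Real.exp_le_exp.2
        have hQ2 : (0 : ℝ) < Q ^ 2 := by positivity
        rw [neg_mul, neg_div, neg_le_neg_iff, div_le_iff₀ hQ2]
        nlinarith
      -- `8 e^{0.098 Q} ≤ 8 N exp(−2·10⁻⁹ Q)`
      have hE2 : Real.exp (0.98 * (Q / 10)) ≤ (N : ℝ) * Real.exp (-(2e-9 * Q)) := by
        rw [← hNexp, ← Real.exp_add]
        apply Real.exp_le_exp.2
        linarith
      have hN0' : (0 : ℝ) ≤ N := hN0.le
      calc ‖S‖ ≤ (N : ℝ) * Real.exp 10 * Real.exp (-(2e-9 * Q)) + 8 * Real.exp (0.98 * (Q / 10)) := hB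
        _ ≤ (N : ℝ) * Real.exp 10 * E' + 8 * ((N : ℝ) * E') := by
            have h3 : (N : ℝ) * Real.exp (-(2e-9 * Q)) ≤ (N : ℝ) * E' := mul_le_mul_of_nonneg_left hE1 hN0'
            have h4 : (N : ℝ) * Real.exp 10 * Real.exp (-(2e-9 * Q)) ≤ (N : ℝ) * Real.exp 10 * E' :=
              mul_le_mul_of_nonneg_left hE1 (by positivity)
            linarith
        _ = (Real.exp 10 + 8) * N * E' := by ring
  · -- the trivial range: `2·10⁻⁹ L³/Q² ≤ 2`
    push Not at hmain
    have hQ2 : (0 : ℝ) < Q ^ 2 := by positivity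
    have hE1 : Real.exp (-2) ≤ E' := by
      rw [hE']; apply Real.exp_le_exp.2
      rw [neg_mul, neg_div, neg_le_neg_iff, div_le_iff₀ hQ2]
      nlinarith
    have he8 : (1 : ℝ) ≤ Real.exp 10 * Real.exp (-2) := by
      rw [← Real.exp_add]; exact Real.one_le_exp (by norm_num)
    have hN0' : (0 : ℝ) ≤ N := hN0.le
    calc ‖S‖ ≤ N := htriv
      _ ≤ (N : ℝ) * (Real.exp 10 * Real.exp (-2)) := le_mul_of_one_le_right hN0' he8
      _ ≤ (N : ℝ) * (Real.exp 10 * E') := by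
          apply mul_le_mul_of_nonneg_left _ hN0'
          exact mul_le_mul_of_nonneg_left hE1 (by positivity)
      _ ≤ (Real.exp 10 + 8) * N * E' := by nlinarith [mul_nonneg hN0' hE'0.le]

/-! ### The leaf and the stubs, unconditionally -/

/-- ★★★ **`AlignedTypeI` holds**: for every `ε > 0` and all large `n`,
`Σ_{a<2^n} |Σ_{b<2^n} λ(a + 2^n b + 1)| ≤ ε 4^n` — the aligned Type-I bound for the Liouville function on digital
rectangles, PROVED: `HS` (`shortCharSums_bound`) ⟹ `HG` ⟹ `HZ` ⟹ the leaf (`alignedTypeI_of_shortCharSums`).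
[cite: Ivic1985, Theorem 6.2] [cite: MontgomeryVaughan2007, Thm. 11.3] -/
theorem alignedTypeI_proof : Summit.ValiantsHypothesis.ValiantsHypothesis.Theses.LiouvilleSarnak.AlignedTypeI :=
  alignedTypeI_of_shortCharSums (C₁ := Real.exp 10 + 8) (c := 2e-9) (by positivity) (by norm_num)
    shortCharSums_bound

/-- The registered stub `stub_kmtVariance : KMTVariance` of the line `characters_mod_2n`, BY NAME
(`KMTVariance ⟺ AlignedTypeI`, `kmtVariance_iff_alignedTypeI`). [folklore] -/
theorem stub_kmtVariance : KMTVariance :=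
  kmtVariance_iff_alignedTypeI.2 alignedTypeI_proof

/-- The registered stub `stub_twistedLiouvilleSmall : TwistedLiouvilleSmall` of the line `characters_mod_2n`, BY NAME
(`twistedLiouvilleSmall_of_alignedTypeI`). [folklore] -/
theorem stub_twistedLiouvilleSmall : TwistedLiouvilleSmall :=
  twistedLiouvilleSmall_of_alignedTypeI alignedTypeI_proof

end Summit.ValiantsHypothesis.ValiantsHypothesis.Theorems.LiouvilleSarnak.AlignedTypeI.CharactersModTwoN
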